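import Literature.Analysis.Fourier.HilbertTransformLine
import Mathlib.Analysis.SpecialFunctions.Integrability.Basic
import Mathlib.Analysis.SpecialFunctions.ImproperIntegrals
import Mathlib.MeasureTheory.Measure.Haar.NormedSpace
import Mathlib.MeasureTheory.Integral.IntervalIntegral.FundThmCalculus
import HarnessLib

/-!
# SHEET-ℝ frame: the symmetric p.v. integrand of an `H¹` function is integrable at EVERY point

HONEST FRAMING (cell ns-blowup GROUP B / zone Z3, case Z3-SR-CERT; 1-D MODEL certificate frame; not Euler/NS).

The isometry theorems for the line Hilbert transform on the energy class (profile-cert-2 g3: `HilbertTransformLineL2Density.lean`,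
`eLpNorm_hilbertTransform_eq_of_memLp`, `integral_weight_mul_hilbertTransform_sq_eq_of_memLp`) carry one remaining hypothesis:
`∀ x, IntegrableOn (fun t => (δ(x−t) − δ(x+t))/t) (Ioi 0)`. This file discharges it for every `δ ∈ C¹(ℝ)` with `δ, δ′ ∈ L²`
(`integrableOn_symmIntegrand_of_sq_integrable`) — so on `E ∩ C¹` (the centre `Ω̄`, the frame functions, and the certified profile `Ω*`, which is
`C²` by its equation) the isometries hold with NO residual hypothesis. Proof without Hölder: near `t = 0`,
`|δ(x−t) − δ(x+t)| ≤ ∫_{x−t}^{x+t}|δ′| ≤ (t^{−1/2}·2t + t^{1/2}∫δ′²)/2 = (1 + ½‖δ′‖₂²)·√t` (pointwise AM–GM `2|d| ≤ s + d²/s` at `s = t^{−1/2}`),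
so the integrand is `≤ (1 + ½‖δ′‖₂²)·t^{−1/2}` on `(0, 1]`; far out, `|δ(x∓t)|/t ≤ ½(δ(x∓t)² + t⁻²)` on `(1, ∞)`. Pure calculus; no definition,
no named fact; MODEL frame bookkeeping only.
-/

noncomputable section

namespace Summit.NavierStokesRegularity.OSWSelfSimilar
namespace SheetRPVIntegrable

open _root_.MeasureTheory _root_.Set _root_.Filter
open scoped Real Topology

/-- Pointwise AM–GM: `|d| ≤ (s + s⁻¹·d²)/2` for `s > 0`. [folklore] -/
private theorem abs_le_half_add {d s : ℝ} (hs : 0 < s) : |d| ≤ (s + s⁻¹ * d ^ 2) / 2 := by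
  have key : 2 * s * |d| ≤ s ^ 2 + d ^ 2 := by nlinarith [sq_nonneg (s - |d|), sq_abs d, abs_nonneg d]
  rw [le_div_iff₀ (by norm_num : (0 : ℝ) < 2)]
  have h2 : s + s⁻¹ * d ^ 2 = (s ^ 2 + d ^ 2) / s := by field_simp
  rw [h2, le_div_iff₀ hs]
  linarith

/-- **Near bound.** For `δ ∈ C¹` with `A := ∫ δ′² < ∞` and `0 < t`: `|δ(x−t) − δ(x+t)| ≤ (1 + A/2)·√t`. [folklore] -/
theorem abs_sub_le_sqrt {δ : ℝ → ℝ} (hδ : ContDiff ℝ 1 δ) (h1 : Integrable (fun y => deriv δ y ^ 2)) {t : ℝ} (ht : 0 < t) (x : ℝ) :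
    |δ (x - t) - δ (x + t)| ≤ (1 + (∫ y, deriv δ y ^ 2) / 2) * Real.sqrt t := by
  have hc' : Continuous (deriv δ) := hδ.continuous_deriv le_rfl
  have hd : ∀ y, HasDerivAt δ (deriv δ y) y := fun y => (hδ.differentiable (by norm_num) y).hasDerivAt
  set A : ℝ := ∫ y, deriv δ y ^ 2 with hA
  have hab : x - t ≤ x + t := by linarith
  -- FTC
  have hftc : ∫ y in (x - t)..(x + t), deriv δ y = δ (x + t) - δ (x - t) :=
    intervalIntegral.integral_eq_sub_of_hasDerivAt (fun y _ => hd y) (hc'.intervalIntegrable _ _)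
  have hst : 0 < Real.sqrt t := Real.sqrt_pos.mpr ht
  set s : ℝ := (Real.sqrt t)⁻¹ with hs_def
  have hs : 0 < s := inv_pos.mpr hst
  -- |∫ δ′| ≤ ∫ |δ′| ≤ ∫ (s + s⁻¹ δ′²)/2
  have h2 : |∫ y in (x - t)..(x + t), deriv δ y| ≤ ∫ y in (x - t)..(x + t), |deriv δ y| :=
    intervalIntegral.abs_integral_le_integral_abs hab
  have hI3 : IntervalIntegrable (fun y => (s + s⁻¹ * deriv δ y ^ 2) / 2) volume (x - t) (x + t) :=
    ((continuous_const.add (continuous_const.mul (hc'.pow 2))).div_const 2 :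
      Continuous fun y => (s + s⁻¹ * deriv δ y ^ 2) / 2).intervalIntegrable _ _
  have hIabs : IntervalIntegrable (fun y => |deriv δ y|) volume (x - t) (x + t) :=
    (hc'.abs : Continuous fun y => |deriv δ y|).intervalIntegrable _ _
  have h3 : ∫ y in (x - t)..(x + t), |deriv δ y| ≤ ∫ y in (x - t)..(x + t), (s + s⁻¹ * deriv δ y ^ 2) / 2 :=
    intervalIntegral.integral_mono_on hab hIabs hI3 fun y _ => abs_le_half_add hs
  have hI2 : IntervalIntegrable (fun y => s⁻¹ * deriv δ y ^ 2) volume (x - t) (x + t) :=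
    (continuous_const.mul (hc'.pow 2) : Continuous fun y => s⁻¹ * deriv δ y ^ 2).intervalIntegrable _ _
  have h4a : ∫ y in (x - t)..(x + t), (s + s⁻¹ * deriv δ y ^ 2) / 2
      = (∫ y in (x - t)..(x + t), (s + s⁻¹ * deriv δ y ^ 2)) / 2 := intervalIntegral.integral_div _ _
  have h4b : ∫ y in (x - t)..(x + t), (s + s⁻¹ * deriv δ y ^ 2)
      = (∫ _y in (x - t)..(x + t), s) + ∫ y in (x - t)..(x + t), s⁻¹ * deriv δ y ^ 2 :=
    intervalIntegral.integral_add intervalIntegrable_const hI2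
  have h4c : ∫ _y in (x - t)..(x + t), s = (x + t - (x - t)) • s := intervalIntegral.integral_const _
  have h4d : ∫ y in (x - t)..(x + t), s⁻¹ * deriv δ y ^ 2 = s⁻¹ * ∫ y in (x - t)..(x + t), deriv δ y ^ 2 :=
    intervalIntegral.integral_const_mul _ _
  have h4 : ∫ y in (x - t)..(x + t), (s + s⁻¹ * deriv δ y ^ 2) / 2
      = (s * (2 * t) + s⁻¹ * ∫ y in (x - t)..(x + t), deriv δ y ^ 2) / 2 := by
    rw [h4a, h4b, h4c, h4d, smul_eq_mul]
    ring
  have h5 : ∫ y in (x - t)..(x + t), deriv δ y ^ 2 ≤ A := by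
    rw [intervalIntegral.integral_of_le hab]
    exact setIntegral_le_integral h1 (Eventually.of_forall fun y => sq_nonneg _)
  have h6 : |δ (x - t) - δ (x + t)| ≤ (s * (2 * t) + s⁻¹ * A) / 2 := by
    rw [abs_sub_comm, ← hftc]
    calc |∫ y in (x - t)..(x + t), deriv δ y| ≤ ∫ y in (x - t)..(x + t), (s + s⁻¹ * deriv δ y ^ 2) / 2 := h2.trans h3
      _ = (s * (2 * t) + s⁻¹ * ∫ y in (x - t)..(x + t), deriv δ y ^ 2) / 2 := h4
      _ ≤ (s * (2 * t) + s⁻¹ * A) / 2 := by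
          gcongr
  -- evaluate at s = 1/√t:  (2t/√t + √t A)/2 = √t (1 + A/2)
  have ht' : Real.sqrt t * Real.sqrt t = t := Real.mul_self_sqrt ht.le
  calc |δ (x - t) - δ (x + t)| ≤ (s * (2 * t) + s⁻¹ * A) / 2 := h6
    _ = (1 + A / 2) * Real.sqrt t := by
        rw [hs_def, inv_inv]
        field_simp
        nlinarith [ht']

/-- **The symmetric p.v. integrand of a `C¹ ∩ H¹` function is integrable on `(0, ∞)` at every point.** [folklore] -/
theorem integrableOn_symmIntegrand_of_sq_integrable {δ : ℝ → ℝ} (hδ : ContDiff ℝ 1 δ)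
    (h0 : Integrable (fun y => δ y ^ 2)) (h1 : Integrable (fun y => deriv δ y ^ 2)) (x : ℝ) :
    IntegrableOn (fun t => (δ (x - t) - δ (x + t)) / t) (Ioi 0) := by
  have hc : Continuous δ := hδ.continuous
  set A : ℝ := ∫ y, deriv δ y ^ 2 with hA
  have hA0 : 0 ≤ A := integral_nonneg fun y => sq_nonneg _
  -- measurability on (0, ∞)
  have hmeas : AEStronglyMeasurable (fun t => (δ (x - t) - δ (x + t)) / t) volume :=
    (((hc.comp (continuous_const.sub continuous_id)).sub (hc.comp (continuous_const.add continuous_id))).measurable.div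
      measurable_id).aestronglyMeasurable
  -- split (0, ∞) = (0, 1] ∪ (1, ∞)
  have hsplit : Ioi (0 : ℝ) = Ioc 0 1 ∪ Ioi 1 := (Ioc_union_Ioi_eq_Ioi zero_le_one).symm
  rw [hsplit]
  refine IntegrableOn.union ?_ ?_
  · -- near piece: domination by (1 + A/2) t^{-1/2}
    have hdom : IntegrableOn (fun t : ℝ => (1 + A / 2) * t ^ (-(1 / 2 : ℝ))) (Ioc 0 1) := by
      have h := (intervalIntegral.intervalIntegrable_rpow' (a := 0) (b := 1) (r := -(1 / 2 : ℝ)) (by norm_num)).const_mul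
        (1 + A / 2)
      exact (intervalIntegrable_iff_integrableOn_Ioc_of_le zero_le_one).mp h
    refine Integrable.mono' hdom hmeas.restrict ?_
    refine ae_restrict_of_forall_mem measurableSet_Ioc fun t ht => ?_
    have ht0 : 0 < t := ht.1
    rw [Real.norm_eq_abs, abs_div, abs_of_pos ht0, div_le_iff₀ ht0]
    have hb := abs_sub_le_sqrt hδ h1 ht0 x
    have hrpow : t ^ (-(1 / 2 : ℝ)) * t = Real.sqrt t := by
      rw [Real.sqrt_eq_rpow, show -(1 / 2 : ℝ) = (1 / 2 : ℝ) - 1 by norm_num, Real.rpow_sub_one ht0.ne']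
      field_simp
    calc |δ (x - t) - δ (x + t)| ≤ (1 + A / 2) * Real.sqrt t := hb
      _ = (1 + A / 2) * t ^ (-(1 / 2 : ℝ)) * t := by rw [mul_assoc, hrpow]
  · -- far piece: domination by (δ(x−t)² + δ(x+t)²)/2 + t^{-2}
    have hsq1 : Integrable (fun t : ℝ => δ (x - t) ^ 2) := h0.comp_sub_left x
    have hsq2 : Integrable (fun t : ℝ => δ (x + t) ^ 2) := h0.comp_add_left x
    have hpow : IntegrableOn (fun t : ℝ => t ^ (-2 : ℝ)) (Ioi 1) := integrableOn_Ioi_rpow_of_lt (by norm_num) one_pos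
    have hdom : IntegrableOn (fun t : ℝ => (δ (x - t) ^ 2 + δ (x + t) ^ 2) / 2 + t ^ (-2 : ℝ)) (Ioi 1) :=
      ((hsq1.add hsq2).div_const 2).integrableOn.add hpow
    refine Integrable.mono' hdom hmeas.restrict ?_
    refine ae_restrict_of_forall_mem measurableSet_Ioi fun t ht => ?_
    have ht1 : 1 < t := ht
    have ht0 : 0 < t := by linarith
    rw [Real.norm_eq_abs, abs_div, abs_of_pos ht0]
    have hp : t ^ (-2 : ℝ) = (t ^ 2)⁻¹ := by
      rw [Real.rpow_neg ht0.le, show (2 : ℝ) = ((2 : ℕ) : ℝ) by norm_num, Real.rpow_natCast]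
    rw [hp]
    -- |a − b|/t ≤ (|a| + |b|)/t ≤ (a² + t⁻²)/2 + (b² + t⁻²)/2
    have hkey : ∀ a : ℝ, |a| / t ≤ (a ^ 2 + (t ^ 2)⁻¹) / 2 := by
      intro a
      rw [div_le_iff₀ ht0]
      have h := abs_le_half_add (d := a) (s := t⁻¹) (inv_pos.mpr ht0)
      rw [inv_inv] at h
      have : (t⁻¹ + t * a ^ 2) / 2 = (a ^ 2 + (t ^ 2)⁻¹) / 2 * t := by
        field_simp
        ring
      linarith [this ▸ h]
    calc |δ (x - t) - δ (x + t)| / t ≤ (|δ (x - t)| + |δ (x + t)|) / t := by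
          gcongr; exact abs_sub _ _
      _ = |δ (x - t)| / t + |δ (x + t)| / t := by ring
      _ ≤ (δ (x - t) ^ 2 + (t ^ 2)⁻¹) / 2 + (δ (x + t) ^ 2 + (t ^ 2)⁻¹) / 2 := add_le_add (hkey _) (hkey _)
      _ = (δ (x - t) ^ 2 + δ (x + t) ^ 2) / 2 + (t ^ 2)⁻¹ := by ring

/-- Convenience form matching the isometry theorems' hypothesis literally: for `δ ∈ C¹` with `δ, δ′ ∈ L²`,
`∀ x, IntegrableOn (fun t => (δ (x - t) - δ (x + t)) / t) (Ioi 0)`. [folklore] -/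
theorem forall_integrableOn_symmIntegrand {δ : ℝ → ℝ} (hδ : ContDiff ℝ 1 δ)
    (h0 : Integrable (fun y => δ y ^ 2)) (h1 : Integrable (fun y => deriv δ y ^ 2)) :
    ∀ x : ℝ, IntegrableOn (fun t => (δ (x - t) - δ (x + t)) / t) (Ioi 0) :=
  fun x => integrableOn_symmIntegrand_of_sq_integrable hδ h0 h1 x

end SheetRPVIntegrable
end Summit.NavierStokesRegularity.OSWSelfSimilar

end
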